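import Summits.Ventures.QEC.Census.CertCheck
import HarnessLib

/-!
# Distance certificate DATA for the census row `S8_28_w8_k8_0146B01` (family GB) as `S8_28_w8_k8_0146B01.cert` — emitted by qec-type-07 (07.MITMK)

Source certificate: `cert/search-8/2bga-g28-A0.1.4.6-B0.1.13.25.certA.json` — kernel A, id (sha256) `b6011f7f4f7f124e9977a1d1ad044c8ace245d509210b091dc8a6b70eaecfb92` (`certA=b6011f7f4f7f124e`),
lower-bound methods mitm (Z) / mitm (X) as RUN BY KERNEL A; here only its matrices,
upper witnesses and allow-lists are data — the lower bound is RE-ESTABLISHED in the kernel by the meet-in-the-middle lane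
`Census/CertMitmK.lean` (sibling files `MitmKZ*.lean` — Z side; the X side by the kernel X↔Z swap of `Census/CertCheckXZSwap.lean`), the row theorem is `GB/S8_28_w8_k8_0146B01/Distance.lean`.
Code: n = 56, 28 X-checks, 28 Z-checks; construction {"type": "explicit"}; generators
`/work/gens/s8/2bga-g28-A0.1.4.6-B0.1.13.25.json` (matrix_sha256 `82d01d285902ada44dd53929f11e298df1a9d30546d0e1edf0106027c9cf5fb3`); claimed (n, k, dZ, dX) =
(56, 8, 8, 8) — a CLAIM of the certificate until the sibling theorems; printed/third-party
value: none (census-discovered code).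
Allow-lists (`found`): side Z: the certificate's 0 words verbatim; side X: the certificate's list verbatim (not used: the X side follows by the kernel X↔Z swap, `Distance.lean`).
Format = qec-search-7's `emit_lean.py` (`Census/<F>/<Code>/Cert.lean` convention: supports as binary numerals, bit `j` =
qubit `j` of the gens file, identity layout). This file is DATA: no theorem, no `decide`. Generated 2026-08-27T06:45Z by
HOME/census/type-07/emit_mitmk.py; do not edit by hand — re-emit.
-/

namespace Summit.Ventures.QEC.Census.S8_28_w8_k8_0146B01

/-- The distance certificate of `S8_28_w8_k8_0146B01` as a `DistCert` literal (CERT-FORMAT v1 kernel fields; certificate id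
`b6011f7f4f7f124e`): `n = 56`, `HX`/`HZ` = the 28 + 28 check rows (words as binary numerals (bit `j` = qubit `j`)), side Z =
(d := 8, weight-8 Z-logical witness, its non-membership witness, allow-list of 0 stabilizer words with
their row decompositions), side X likewise (d := 8, 0 words). -/
def cert : DistCert where
  n := 56
  HX := [
    9009399083302995, 18018798166605990, 36037596333211980, 17598896931480, 35197793862960, 70395587725920,
    140791175451840, 281582350903680, 563164701807360, 1126329403614720, 2252658807229440, 4505317614458880,
    9010635228917760, 18021270457835520, 36042540915671040, 27488061849600, 54976123699200, 109952247398400,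
    219904494796800, 439808989593600, 879617979187200, 1759235958374400, 3518471648313345, 7036943296626690,
    14073886324817925, 28147772649635850, 56295545299271700, 40533496560615465]
  HZ := [
    41658296955863049, 11258999873798163, 22517999747596326, 45035999495192652, 18014405220892824, 36028810441785648,
    27114078816, 54228157632, 108456315264, 216912630528, 433825261056, 867650522112,
    1735301044224, 3470333652993, 6940667305986, 13881334611972, 27762669223944, 55525338447888,
    111050676895776, 222101353791552, 444202707583104, 888405415166208, 1776810830332416, 3553621660664832,
    7107243321329664, 14214486374223873, 28428972748447746, 56857945496895492]
  sideZ := { d := 8, witness := 18023748653811752, nonmember := 3706926169,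
             found := [] }
  sideX := { d := 8, witness := 738871817273380, nonmember := 23250315,
             found := [] }

end Summit.Ventures.QEC.Census.S8_28_w8_k8_0146B01
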